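import Summits.CriticalPhenomena.Ising3DConformalLimit.Theorems.PerfectScreeningCoulombImpliesNontrivialIsothermOfOneArm
import Summits.CriticalPhenomena.Ising3DConformalLimit.Theorems.AnomalousForcesInteractionEtaPositiveOfIsotherm
import HarnessLib

/-!
# The upper critical isotherm from a one-arm rate, for every exponent (crux `EtaPositive`, stmt-CriticalPhenomena-2600)

Route `AnomalousForcesInteraction` (Ising3DConformalLimit), line `birth`. The crux has two pre-paid conditional
closings: `EtaPositive_of_isothermGain` (X₁ = `stub_isothermGain`, "`1/δ > 1/5` in upper-bound form",
`Theorems/AnomalousForcesInteractionEtaPositiveOfIsotherm.lean`) and `EtaPositive_of_oneArmGain` (X₂ = a polynomial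
upper bound `⟨σ₀⟩⁺_{box L; β_c(3), 0} ≤ C L^{-a}` on the plus-boundary magnetisation at the centre of a critical box
with SOME `a > 1/2`, `Theorems/AnomalousForcesInteractionEtaPositiveOfOneArm.lean`). This file ORDERS them:

* `magnetizationInField_le_boxMag_add` — the per-box extrapolation bound at `β_c(3)`, with no hypothesis:
  `m(β_c, h) ≤ ⟨σ₀⟩⁺_{box L; β_c, 0} + β_c K L² h` for every `L ≥ 1`, `h ≥ 0` (`K` the infrared box-sum constant,
  `Σ_{box M} ⟨σ₀σ_z⟩_{β_c} ≤ K M²`): plus boxes decrease to the plus state, GHS tangent line in the field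
  (`boxMag_le_zeroField_add_field_mul`), GHS volume monotonicity with `m*(β_c) = 0`
  (`isingTrunc_plus_box_le_plusExpect`), infrared bound (`sum_box_criticalTwoPoint_le`) — the sibling crux's
  `magnetizationInField_le_of_oneArm_box` (route PerfectScreening, exponent `1/2` hard-wired) with the one-arm
  quantity kept on the right-hand side;
* `isotherm_of_oneArm` — **one-arm rate `a` ⟹ isotherm rate `a/(2+a)`**: if `⟨σ₀⟩⁺_{box L; β_c(3), 0} ≤ C L^{-a}`
  for `L ≥ L₀` with some `a > 0`, then `m(β_c(3), h) ≤ A h^{a/(2+a)}` on `(0, h₀]` (`L = ⌈h^{-1/(2+a)}⌉`);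
* `isothermGain_of_oneArmGain` — hence X₂ ⟹ X₁ (`a > 1/2 ⟺ a/(2+a) > 1/5`): of the two promoted-item candidates
  recorded in `Cruxes/EtaPositive/PROMOTE.md`, the isotherm gain is the WEAKER hypothesis (the converse implication is
  not known), so it is the one to file; and `EtaPositive_of_oneArmGain` factors through `EtaPositive_of_isothermGain`
  (with the worse exponent `κ = (5b-1)/(b+1)`, `b = a/(2+a)`, versus `2a - 1` by direct GKS decoupling).

With `a = 1/2` (the canonical one-arm exponent, e.g. from `OneArmHyperscaling` of route ArmHyperscaling plus the
infrared bound) the output is `b = 1/5` exactly, which the effective Buckingham–Gunton reduction maps back to the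
infrared exponent `1`: the transfer creates no exponent, it transports one (cf. PROMOTE.md §3, row 1).
-/

noncomputable section

namespace Summit.CriticalPhenomena.Ising3DConformalLimit.AnomalousForcesInteractionEtaPositive

open Literature.Probability.LatticeModels Filter Set Finset
open scoped Topology BigOperators

/-- **Per-box extrapolation bound at `β_c(3)`** (no hypothesis): with `K` the infrared box-sum constant of
`PerfectScreeningCoulombImpliesNontrivial.sum_box_criticalTwoPoint_le`, for every `h ≥ 0` and `L ≥ 1`,
`m(β_c, h) ≤ ⟨σ₀⟩⁺_{box L; β_c, 0} + β_c K L² h`. Proof: `m(β_c,h) ≤ ⟨σ₀⟩⁺_{box L; β_c, h}` (plus boxes decrease to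
the plus state), GHS tangent line `⟨σ₀⟩⁺_{Λ,h} ≤ ⟨σ₀⟩⁺_{Λ,0} + β_c h Σ_{y∈Λ}⟨σ₀;σ_y⟩⁺_{Λ,0}`, and
`⟨σ₀;σ_y⟩⁺_{Λ;β_c,0} ≤ ⟨σ₀σ_y⟩_{β_c}` (GHS volume monotonicity, `m*(β_c) = 0`), `Σ_{y ∈ box L}⟨σ₀σ_y⟩_{β_c} ≤ K L²`. -/
theorem magnetizationInField_le_boxMag_add :
    ∃ K : ℝ, 0 ≤ K ∧ ∀ (h : ℝ), 0 ≤ h → ∀ (L : ℕ), 1 ≤ L →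
      magnetizationInField 3 (criticalBeta 3) h ≤
        isingExpect (zdGraph 3) (box 3 L) (criticalBeta 3) 0 .plus (spinAt 0) +
          criticalBeta 3 * K * (L : ℝ) ^ 2 * h := by
  obtain ⟨K, hK0, hK⟩ := PerfectScreeningCoulombImpliesNontrivial.sum_box_criticalTwoPoint_le
  refine ⟨K, hK0, fun h hh L hL => ?_⟩
  have hβ : 0 < criticalBeta 3 := criticalBeta_pos_holds (d := 3) (by norm_num)
  -- `m(h) ≤ ⟨σ₀⟩⁺_{box L, h}`
  have h1 : magnetizationInField 3 (criticalBeta 3) h ≤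
      isingExpect (zdGraph 3) (box 3 L) (criticalBeta 3) h .plus (spinAt 0) := by
    have hle := plusCorr_le_isingCorr_plus_box (d := 3) hβ.le hh
      (A := {0}) (L := L) (Finset.singleton_subset_iff.2 (zero_mem_box 3 L))
    rw [magnetizationInField_eq_plusCorr]
    refine hle.trans_eq ?_
    simp only [isingCorr]
    congr 1
    funext σ
    simp [spinProduct]
  -- the truncated plus-box two-point functions at `h = 0` are bounded by `G(y)`
  have hm0 : plusExpect 3 (criticalBeta 3) 0 (spinAt 0) = 0 :=
    spontaneousMagnetization_criticalBeta_eq_zero_holds (d := 3) (by norm_num)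
  have h2 : ∀ y ∈ box 3 L,
      isingExpect (zdGraph 3) (box 3 L) (criticalBeta 3) 0 .plus (fun σ => spinAt 0 σ * spinAt y σ) -
          isingExpect (zdGraph 3) (box 3 L) (criticalBeta 3) 0 .plus (spinAt 0) *
            isingExpect (zdGraph 3) (box 3 L) (criticalBeta 3) 0 .plus (spinAt y) ≤
        criticalTwoPoint 3 y := by
    intro y hy
    have hle := PerfectScreeningCoulombImpliesNontrivial.isingTrunc_plus_box_le_plusExpect (d := 3) hβ.le le_rfl
      (zero_mem_box 3 L) hy
    refine hle.trans ?_
    rw [hm0, zero_mul, sub_zero]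
    exact le_of_eq rfl
  have h3 : ∑ y ∈ box 3 L,
      (isingExpect (zdGraph 3) (box 3 L) (criticalBeta 3) 0 .plus (fun σ => spinAt 0 σ * spinAt y σ) -
        isingExpect (zdGraph 3) (box 3 L) (criticalBeta 3) 0 .plus (spinAt 0) *
          isingExpect (zdGraph 3) (box 3 L) (criticalBeta 3) 0 .plus (spinAt y)) ≤ K * (L : ℝ) ^ 2 :=
    (Finset.sum_le_sum h2).trans (hK L hL)
  have h4 := PerfectScreeningCoulombImpliesNontrivial.boxMag_le_zeroField_add_field_mul (d := 3) hβ.le hh L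
  calc magnetizationInField 3 (criticalBeta 3) h
      ≤ isingExpect (zdGraph 3) (box 3 L) (criticalBeta 3) h .plus (spinAt 0) := h1
    _ ≤ isingExpect (zdGraph 3) (box 3 L) (criticalBeta 3) 0 .plus (spinAt 0) +
        criticalBeta 3 * (∑ y ∈ box 3 L,
          (isingExpect (zdGraph 3) (box 3 L) (criticalBeta 3) 0 .plus (fun σ => spinAt 0 σ * spinAt y σ) -
            isingExpect (zdGraph 3) (box 3 L) (criticalBeta 3) 0 .plus (spinAt 0) *
              isingExpect (zdGraph 3) (box 3 L) (criticalBeta 3) 0 .plus (spinAt y))) * h := h4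
    _ ≤ isingExpect (zdGraph 3) (box 3 L) (criticalBeta 3) 0 .plus (spinAt 0) +
        criticalBeta 3 * (K * (L : ℝ) ^ 2) * h := by
        gcongr
    _ = isingExpect (zdGraph 3) (box 3 L) (criticalBeta 3) 0 .plus (spinAt 0) +
        criticalBeta 3 * K * (L : ℝ) ^ 2 * h := by ring

/-- The one-point plus-box correlation `isingCorr … .plus {0}` is the plus-box magnetisation `⟨σ₀⟩⁺_{box L}`. -/
theorem isingCorr_plus_box_singleton_zero (β h : ℝ) (L : ℕ) :
    isingCorr (zdGraph 3) (box 3 L) β h .plus ({0} : Finset (Site 3)) =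
      isingExpect (zdGraph 3) (box 3 L) β h .plus (spinAt 0) := by
  simp only [isingCorr]
  congr 1
  funext σ
  simp [spinProduct]

/-- **One-arm rate `a` ⟹ isotherm rate `a/(2+a)` at `β_c(3)`.** If the plus-boundary magnetisation at the centre
of the critical box obeys `⟨σ₀⟩⁺_{box L; β_c(3), 0} ≤ C L^{-a}` for all `L ≥ L₀`, with some `a > 0`, then
`m(β_c(3), h) ≤ A h^{a/(2+a)}` for all `h ∈ (0, h₀]`. Proof: `magnetizationInField_le_boxMag_add` at the scale
`L = ⌈h^{-1/(2+a)}⌉` (admissible once `h ≤ (L₀+1)^{-(2+a)}`), where `L^{-a} ≤ h^{a/(2+a)}` and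
`L² h ≤ 4 h^{-2/(2+a)} h = 4 h^{a/(2+a)}`. The case `a = 1/2`, `b = 1/5` is the sibling crux's
`PerfectScreeningCoulombImpliesNontrivial.stub_isothermOfOneArm`. -/
theorem isotherm_of_oneArm {a C : ℝ} {L₀ : ℕ} (ha : 0 < a)
    (hC : ∀ L : ℕ, L₀ ≤ L →
      isingCorr (zdGraph 3) (box 3 L) (criticalBeta 3) 0 .plus ({0} : Finset (Site 3)) ≤ C * (L : ℝ) ^ (-a)) :
    ∃ A h₀ : ℝ, 0 < h₀ ∧ ∀ h : ℝ, 0 < h → h ≤ h₀ →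
      magnetizationInField 3 (criticalBeta 3) h ≤ A * h ^ (a / (2 + a)) := by
  obtain ⟨K, hK0, hK⟩ := magnetizationInField_le_boxMag_add
  have hβ : 0 < criticalBeta 3 := criticalBeta_pos_holds (d := 3) (by norm_num)
  have h2a : 0 < 2 + a := by linarith
  set C' : ℝ := max C 0 with hC'
  have hC'0 : 0 ≤ C' := le_max_right _ _
  -- the admissible field range: `h ≤ h₀ := (L₀+1)^{-(2+a)}` forces `⌈h^{-1/(2+a)}⌉ ≥ L₀ + 1`
  set h₀ : ℝ := ((L₀ : ℝ) + 1) ^ (-(2 + a)) with hh₀def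
  have hL₀1 : (1 : ℝ) ≤ (L₀ : ℝ) + 1 := by
    have : (0 : ℝ) ≤ L₀ := Nat.cast_nonneg _
    linarith
  have hL₀pos : (0 : ℝ) < (L₀ : ℝ) + 1 := by linarith
  have hh₀ : 0 < h₀ := Real.rpow_pos_of_pos hL₀pos _
  have hh₀1 : h₀ ≤ 1 := Real.rpow_le_one_of_one_le_of_nonpos hL₀1 (by linarith)
  refine ⟨C' + 4 * (criticalBeta 3 * K), h₀, hh₀, fun h hh hhh₀ => ?_⟩
  have hh1 : h ≤ 1 := hhh₀.trans hh₀1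
  -- the scale `x = h^{-1/(2+a)} ≥ L₀ + 1 ≥ 1` and `L = ⌈x⌉`
  set x : ℝ := h ^ (-(1 / (2 + a))) with hx
  have hxL₀ : (L₀ : ℝ) + 1 ≤ x := by
    have h1 : h ^ (-(1 / (2 + a))) ≥ h₀ ^ (-(1 / (2 + a))) :=
      Real.rpow_le_rpow_of_nonpos hh hhh₀ (by
        have : 0 < 1 / (2 + a) := by positivity
        linarith)
    have h2 : h₀ ^ (-(1 / (2 + a))) = (L₀ : ℝ) + 1 := by
      rw [hh₀def, ← Real.rpow_mul hL₀pos.le]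
      have : -(2 + a) * -(1 / (2 + a)) = 1 := by field_simp
      rw [this, Real.rpow_one]
    rw [hx]
    linarith [h1, h2.le, h2.ge]
  have hx1 : 1 ≤ x := hL₀1.trans hxL₀
  have hx0 : 0 < x := one_pos.trans_le hx1
  set L : ℕ := ⌈x⌉₊ with hLdef
  have hLx : x ≤ (L : ℝ) := Nat.le_ceil x
  have hL1 : 1 ≤ L := Nat.one_le_ceil_iff.2 hx0
  have hLL₀ : L₀ ≤ L := by
    have : (L₀ : ℝ) + 1 ≤ (L : ℝ) := hxL₀.trans hLx
    exact_mod_cast (by linarith : (L₀ : ℝ) ≤ L)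
  have hL2x : (L : ℝ) ≤ 2 * x := by
    have := Nat.ceil_lt_add_one hx0.le
    rw [← hLdef] at this
    linarith
  have hLpos : (0 : ℝ) < L := hx0.trans_le hLx
  -- the one-arm input at scale `L`
  have hC' : isingExpect (zdGraph 3) (box 3 L) (criticalBeta 3) 0 .plus (spinAt 0) ≤ C' * (L : ℝ) ^ (-a) := by
    rw [← isingCorr_plus_box_singleton_zero]
    exact (hC L hLL₀).trans (mul_le_mul_of_nonneg_right (le_max_left _ _) (by positivity))
  -- `L^{-a} ≤ x^{-a} = h^{a/(2+a)}`
  have hpow1 : (L : ℝ) ^ (-a) ≤ h ^ (a / (2 + a)) := by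
    have h1 : (L : ℝ) ^ (-a) ≤ x ^ (-a) := Real.rpow_le_rpow_of_nonpos hx0 hLx (by linarith)
    have h2 : x ^ (-a) = h ^ (a / (2 + a)) := by
      rw [hx, ← Real.rpow_mul hh.le]
      congr 1
      field_simp
    exact h1.trans_eq h2
  -- `L² h ≤ 4 x² h = 4 h^{a/(2+a)}`
  have hpow2 : (L : ℝ) ^ 2 * h ≤ 4 * h ^ (a / (2 + a)) := by
    have h1 : (L : ℝ) ^ 2 ≤ 4 * x ^ 2 := by nlinarith
    have h2 : x ^ 2 * h = h ^ (a / (2 + a)) := by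
      rw [hx, ← Real.rpow_natCast, ← Real.rpow_mul hh.le]
      conv_lhs => rw [show (h : ℝ) = h ^ (1:ℝ) from (Real.rpow_one h).symm]
      rw [← Real.rpow_mul hh.le, ← Real.rpow_add hh]
      congr 1
      push_cast
      field_simp
      ring
    calc (L : ℝ) ^ 2 * h ≤ 4 * x ^ 2 * h := mul_le_mul_of_nonneg_right h1 hh.le
      _ = 4 * (x ^ 2 * h) := by ring
      _ = 4 * h ^ (a / (2 + a)) := by rw [h2]
  have hmain := hK h hh.le L hL1
  calc magnetizationInField 3 (criticalBeta 3) h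
      ≤ isingExpect (zdGraph 3) (box 3 L) (criticalBeta 3) 0 .plus (spinAt 0) +
          criticalBeta 3 * K * (L : ℝ) ^ 2 * h := hmain
    _ ≤ C' * (L : ℝ) ^ (-a) + criticalBeta 3 * K * ((L : ℝ) ^ 2 * h) := by
        rw [mul_assoc (criticalBeta 3 * K)]
        exact add_le_add hC' le_rfl
    _ ≤ C' * h ^ (a / (2 + a)) + criticalBeta 3 * K * (4 * h ^ (a / (2 + a))) := by
        gcongr
    _ = (C' + 4 * (criticalBeta 3 * K)) * h ^ (a / (2 + a)) := by ring

/-- **The one-arm gain implies the isotherm gain** (X₂ ⟹ X₁ for the two pre-paid closings of crux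
stmt-CriticalPhenomena-2600): a plus-box one-arm bound with SOME exponent `a > 1/2` gives the registered stub
`stub_isothermGain` verbatim, with `b = a/(2+a) > 1/5`. So `EtaPositive_of_oneArmGain` factors through
`EtaPositive_of_isothermGain` (the composite `fun h => EtaPositive_of_isothermGain (isothermGain_of_oneArmGain h)` has
the type of the landed `EtaPositive_of_oneArmGain` and is not restated), and the isotherm gain is the weaker of the
two promoted-item candidates. -/
theorem isothermGain_of_oneArmGain :
    (∃ a C : ℝ, ∃ L₀ : ℕ, 1 / 2 < a ∧ ∀ L : ℕ, L₀ ≤ L →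
      isingCorr (zdGraph 3) (box 3 L) (criticalBeta 3) 0 .plus {0} ≤ C * (L : ℝ) ^ (-a)) →
    ∃ b A h₀ : ℝ, 1 / 5 < b ∧ 0 < h₀ ∧ ∀ h : ℝ, 0 < h → h ≤ h₀ →
      magnetizationInField 3 (criticalBeta 3) h ≤ A * h ^ b := by
  rintro ⟨a, C, L₀, ha, hC⟩
  have ha0 : 0 < a := lt_trans (by norm_num) ha
  obtain ⟨A, h₀, hh₀, H⟩ := isotherm_of_oneArm ha0 hC
  refine ⟨a / (2 + a), A, h₀, ?_, hh₀, H⟩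
  rw [div_lt_div_iff₀ (by norm_num) (by linarith)]
  linarith

end Summit.CriticalPhenomena.Ising3DConformalLimit.AnomalousForcesInteractionEtaPositive

end
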